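import Mathlib
import HarnessLib
import Summits.AtomisticToContinuum.HydrodynamicLimit.Theses.TwoClocks

/-!
# Sketch (crux-ideate, round 1, ideator 1) — crux stmt-AtomisticToContinuum-14442
# `TwoClocks.KineticWindowLDUniform`, idea card `cumulant-linearisation`

First-lemma objects only (no `stub_*`, no `_of`):

* `windowSum` — the crux's window functional `X_{N,τ}(z) = Σᵢ w⁻¹ ∫₀ʷ F((Φ_r z)ᵢ) dr`, `w = τ (N+1)^{-1/3}`,
  written verbatim as in the crux.
* `CumulantTaylorClosure` — FIRST LEMMA (abstract), PROVED below as
  `cumulantTaylorClosure_holds` (Mathlib only: `ProbabilityTheory.analyticOnNhd_cgf`,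
  `AnalyticAt.hasFPowerSeriesAt`, `FormalMultilinearSeries.le_radius_of_bound`,
  `AnalyticOnNhd.eqOn_of_preconnected_of_eventuallyEq`): uniformly factorial bounds
  `|κ_n| ≤ K · n! · Cⁿ` (`n ≥ 2`) on the cumulants at zero tilt, plus exponential integrability on
  `[-R, R]`, give the quadratic bound `cgf X μ t ≤ t·E X + 2 K C² t²` for `|t| ≤ min R (1/(2C))`.
  With `K = ε (N+1)` this is exactly the quantifier shape `∃β₀ ∀β ∀ε ∃τ ∃N₀` of the crux,
  `β₀ = min R (1/(2C))`.
* `WindowCumulantBounds` — the transfer target `C⁺` in the crux's own frame: for the window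
  functional under the local Gibbs law, a FIXED analyticity constant `C` and integrability radius
  `R` (before `ε`), then `∀ε ∃τ ∃N₀ ∀N ≥ N₀`: mean drift `≤ ε (N+1)` and ALL cumulants of order
  `n ≥ 2` bounded by `ε (N+1) n! Cⁿ` ("uniformly factorial and o(1) in the window": sub-ballistic
  accumulation of the time-integrated n-point cumulants of the kinetic mode).
* `CruxOfCumulants` — the shape of the future composition (a `Prop`, not proved here).
-/

noncomputable section

open MeasureTheory ProbabilityTheory Filter Topology Set
open Literature.Analysis.FluidPDE Literature.MathematicalPhysics.KineticTheory

namespace Summit.AtomisticToContinuum.HydrodynamicLimit.Cruxes.KineticWindowLDUniform.IdeatorOne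

/-- The crux's window functional `X_{N,τ}`: sum over particles of the window average of the
one-body observable `F` along the hard-sphere flow, window `w = τ (N+1)^{-1/3}`. -/
def windowSum (σ : ℝ) (N : ℕ)
    (Φ : HardSphereFlow (Torus.geometry (Fin 3)) (hsDiameter σ N) (N + 1))
    (F : T3 × V3 → ℝ) (τ : ℝ) (z : Config (N + 1) (Fin 3) T3) : ℝ :=
  ∑ i : Fin (N + 1), (τ * ((N : ℝ) + 1) ^ (-(1 / 3 : ℝ)))⁻¹ *
    ∫ r in (0 : ℝ)..(τ * ((N : ℝ) + 1) ^ (-(1 / 3 : ℝ))), F (((Φ.flow r z) i))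

/-- **First lemma (Statulevičius–Taylor closure, abstract; PROVED below:
`cumulantTaylorClosure_holds`).** For a probability
measure `μ`, a real random variable `X` with `exp (t X)` integrable for `t ∈ [-R, R]` (interior),
and uniformly factorial cumulant bounds `|iteratedDeriv n (cgf X μ) 0| ≤ K · n! · Cⁿ` for all
`n ≥ 2`, the cumulant generating function is at most `t · E X + 2 K C² t²` on
`|t| ≤ min R (1/(2C))`. Proof route: `cgf` is real-analytic on `(-R, R)`
(`analyticOnNhd_cgf`); the Taylor series at `0` has radius `≥ 1/C` by the bounds; both are analytic
on the connected interval `|t| < min R (1/C)` and agree near `0`, hence agree there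
(`AnalyticOnNhd.eqOn_of_preconnected_of_eventuallyEq`); sum the geometric tail. -/
def CumulantTaylorClosure : Prop :=
  ∀ (Ω : Type) [MeasurableSpace Ω] (μ : Measure Ω) [IsProbabilityMeasure μ] (X : Ω → ℝ)
    (C K R : ℝ), 0 < C → 0 ≤ K → 0 < R →
    Set.Icc (-R) R ⊆ interior (integrableExpSet X μ) →
    (∀ n : ℕ, 2 ≤ n → |iteratedDeriv n (cgf X μ) 0| ≤ K * (n.factorial : ℝ) * C ^ n) →
    ∀ t : ℝ, |t| ≤ min R (1 / (2 * C)) → cgf X μ t ≤ t * (∫ ω, X ω ∂μ) + 2 * K * C ^ 2 * t ^ 2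

/-- **Transfer target `C⁺ = WindowCumulantBounds`** (frame of the crux
`TwoClocks.KineticWindowLDUniform`, verbatim hypotheses): for the window functional
`X = windowSum σ N (Φ N) F τ` under the local Gibbs law `P = localGibbsLaw σ a u₀ θ₀ N (Φ N)` there are
an ANALYTICITY CONSTANT `C` and an INTEGRABILITY RADIUS `R`, fixed before `ε`, such that
`∀ ε > 0 ∃ τ > 0 ∃ N₀ ∀ N ≥ N₀`: (i) `exp (t X)` is `P`-integrable for `t ∈ [-R, R]` (statics:
sub-Gaussian velocity fibres + energy conservation); (ii) the mean drift is small,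
`|E_P X| ≤ ε (N+1)` (non-invariance of the local Gibbs law over a macroscopically vanishing window);
(iii) ALL cumulants of order `n ≥ 2` at zero tilt are uniformly factorial and small:
`|κ_n| ≤ ε (N+1) n! Cⁿ` — sub-ballistic accumulation of the time-integrated `n`-point cumulants of
the kinetic mode, uniformly in `n` (`n = 2`: Cesàro decay of the autocorrelation = zero kinetic
Drude weight; `C⁻¹` bounds the static/hydrodynamic threshold from below). -/
def WindowCumulantBounds : Prop :=
  ∃ η₀ : ℝ, 0 < η₀ ∧ ∀ (a θ₀ : T3 → ℝ) (u₀ : T3 → V3), Continuous a → Continuous θ₀ →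
    Continuous u₀ → (∀ x, 0 < a x) → (∀ x, 0 < θ₀ x) → ∀ σ : ℝ, 0 < σ →
    σ ^ 3 * (⨆ x, a x) ≤ η₀ * ∫ x, a x →
    ∀ Φ : (N : ℕ) → HardSphereFlow (Torus.geometry (Fin 3)) (hsDiameter σ N) (N + 1),
    ∀ F : T3 × V3 → ℝ, Continuous F → (∃ C : ℝ, ∀ y, |F y| ≤ C * (1 + ‖y.2‖ ^ 2)) →
    (∀ x, ∫ v, F (x, v) * localMaxwellian 1 (θ₀ x) (u₀ x) v = 0) →
    (∀ x (j : Fin 3), ∫ v, F (x, v) * v j * localMaxwellian 1 (θ₀ x) (u₀ x) v = 0) →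
    (∀ x, ∫ v, F (x, v) * ‖v‖ ^ 2 * localMaxwellian 1 (θ₀ x) (u₀ x) v = 0) →
    ∃ C R : ℝ, 0 < C ∧ 0 < R ∧ ∀ ε : ℝ, 0 < ε → ∃ τ : ℝ, 0 < τ ∧ ∃ N₀ : ℕ, ∀ N : ℕ, N₀ ≤ N →
      Set.Icc (-R) R ⊆ interior (integrableExpSet (windowSum σ N (Φ N) F τ)
        (localGibbsLaw σ a u₀ θ₀ N (Φ N))) ∧
      |∫ z, windowSum σ N (Φ N) F τ z ∂(localGibbsLaw σ a u₀ θ₀ N (Φ N))| ≤ ε * ((N : ℝ) + 1) ∧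
      ∀ n : ℕ, 2 ≤ n →
        |iteratedDeriv n (cgf (windowSum σ N (Φ N) F τ) (localGibbsLaw σ a u₀ θ₀ N (Φ N))) 0|
          ≤ ε * ((N : ℝ) + 1) * (n.factorial : ℝ) * C ^ n

/-- Shape of the composition a crux-planner would register as `KineticWindowLDUniform_of`
(recorded as a `Prop`; the proof is three steps: the local Gibbs law is a probability measure
under the guard once `η₀ ≤ 1/8`, `∫⁻ ofReal (exp (β X)) dP = ofReal (exp (cgf X P β))` by (i), and
the first lemma with `K = ε (N+1)`, `β₀ = min R (1/(2C))`). -/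
def CruxOfCumulants : Prop :=
  CumulantTaylorClosure → WindowCumulantBounds →
    Summit.AtomisticToContinuum.HydrodynamicLimit.Theses.TwoClocks.KineticWindowLDUniform

/-- **The first lemma is a theorem** (Mathlib only; axioms `propext`, `Classical.choice`,
`Quot.sound`): proof = analyticity of `cgf` on `interior (integrableExpSet X μ)`, the Taylor series
`ofScalars (iteratedDeriv n (cgf X μ) 0 / n!)` (`AnalyticAt.hasFPowerSeriesAt`), radius `≥ 1/C` from
the coefficient bounds (`le_radius_of_bound`), identity theorem on an open interval slightly larger
than `[-R, R] ∩ (-1/C, 1/C)` (`AnalyticOnNhd.eqOn_of_preconnected_of_eventuallyEq`), and a geometric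
tail after splitting off `κ₀ = 0`, `κ₁ = E X`. -/
theorem cumulantTaylorClosure_holds : CumulantTaylorClosure := by
  intro Ω _ μ _ X C K R hC hK hR hsub hbound t ht
  set f : ℝ → ℝ := cgf X μ with hf_def
  have htR : |t| ≤ R := le_trans ht (min_le_left _ _)
  have ht2C : |t| ≤ 1 / (2 * C) := le_trans ht (min_le_right _ _)
  have hCt : C * |t| ≤ 1 / 2 := by
    have := mul_le_mul_of_nonneg_left ht2C hC.le
    calc C * |t| ≤ C * (1 / (2 * C)) := this
      _ = 1 / 2 := by field_simp
  have h0mem : (0 : ℝ) ∈ interior (integrableExpSet X μ) := hsub ⟨by linarith, by linarith⟩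
  -- analyticity of the cgf on the open set `S`
  set S : Set ℝ := interior (integrableExpSet X μ) with hS_def
  have hS_open : IsOpen S := isOpen_interior
  have hf_an : AnalyticOnNhd ℝ f S := analyticOnNhd_cgf
  -- an open interval `U = Ioo (-ρ) ρ` with `t ∈ U`, `U ⊆ S`, `ρ ≤ 1/C`
  obtain ⟨δ, hδpos, hδ⟩ : ∃ δ > 0, Set.Ioo (-(R + δ)) (R + δ) ⊆ S := by
    have hRmem : R ∈ S := hsub ⟨by linarith, le_rfl⟩
    have hRmem' : -R ∈ S := hsub ⟨le_rfl, by linarith⟩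
    obtain ⟨ε₁, hε₁, hb₁⟩ := Metric.isOpen_iff.mp hS_open R hRmem
    obtain ⟨ε₂, hε₂, hb₂⟩ := Metric.isOpen_iff.mp hS_open (-R) hRmem'
    refine ⟨min ε₁ ε₂, lt_min hε₁ hε₂, ?_⟩
    intro y hy
    rcases le_or_gt y (-R) with h1 | h1
    · apply hb₂
      rw [Metric.mem_ball, Real.dist_eq, abs_lt]
      constructor <;> nlinarith [hy.1, min_le_right ε₁ ε₂, min_le_left ε₁ ε₂]
    · rcases lt_or_ge y R with h2 | h2
      · exact hsub ⟨h1.le, h2.le⟩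
      · apply hb₁
        rw [Metric.mem_ball, Real.dist_eq, abs_lt]
        constructor <;> nlinarith [hy.2, min_le_right ε₁ ε₂, min_le_left ε₁ ε₂]
  set ρ : ℝ := min (R + δ) (1 / C) with hρ_def
  have hρpos : 0 < ρ := lt_min (by linarith) (by positivity)
  have htρ : |t| < ρ := by
    refine lt_min (by linarith) ?_
    have : 1 / (2 * C) < 1 / C := by
      rw [div_lt_div_iff₀ (by positivity) hC]; nlinarith
    linarith
  set U : Set ℝ := Set.Ioo (-ρ) ρ with hU_def
  have hU_sub_S : U ⊆ S := by
    intro y hy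
    exact hδ ⟨by linarith [hy.1, min_le_left (R + δ) (1 / C)],
      by linarith [hy.2, min_le_left (R + δ) (1 / C)]⟩
  have htU : t ∈ U := by
    rw [abs_lt] at htρ
    exact ⟨htρ.1, htρ.2⟩
  have h0U : (0 : ℝ) ∈ U := ⟨by linarith, hρpos⟩
  -- the Taylor series of `f` at `0`
  set c : ℕ → ℝ := fun n => iteratedDeriv n f 0 / (n.factorial : ℝ) with hc_def
  set p : FormalMultilinearSeries ℝ ℝ ℝ := FormalMultilinearSeries.ofScalars ℝ c with hp_def
  have hfp : HasFPowerSeriesAt f p 0 := (hf_an 0 h0mem).hasFPowerSeriesAt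
  -- coefficient bounds
  have hc_bound : ∀ n : ℕ, 2 ≤ n → |c n| ≤ K * C ^ n := by
    intro n hn
    have hfac : (0 : ℝ) < (n.factorial : ℝ) := by positivity
    rw [hc_def]
    dsimp only
    rw [abs_div, abs_of_pos hfac, div_le_iff₀ hfac]
    calc |iteratedDeriv n f 0| ≤ K * (n.factorial : ℝ) * C ^ n := hbound n hn
      _ = K * C ^ n * (n.factorial : ℝ) := by ring
  have hc0 : c 0 = 0 := by
    rw [hc_def]
    simp only [iteratedDeriv_zero, Nat.factorial_zero, Nat.cast_one, div_one]
    rw [hf_def, cgf_zero]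
  have hc1 : c 1 = ∫ ω, X ω ∂μ := by
    rw [hc_def]
    simp only [iteratedDeriv_one, Nat.factorial_one, Nat.cast_one, div_one]
    rw [hf_def, deriv_cgf_zero h0mem]
    simp
  -- radius of `p` is at least `1/C`
  have h1C : (0 : ℝ) ≤ 1 / C := by positivity
  have hr_coe : ((Real.toNNReal (1 / C) : NNReal) : ℝ) = 1 / C := Real.coe_toNNReal _ h1C
  have hradius : ENNReal.ofReal (1 / C) ≤ p.radius := by
    have key : ∀ n : ℕ, ‖p n‖ * ((Real.toNNReal (1 / C) : NNReal) : ℝ) ^ n ≤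
        max K (|c 1| * (1 / C)) := by
      intro n
      rw [hp_def, FormalMultilinearSeries.ofScalars_norm, hr_coe, Real.norm_eq_abs]
      rcases Nat.lt_or_ge n 2 with hn | hn
      · interval_cases n
        · rw [hc0]; simp only [abs_zero, pow_zero, mul_one]
          exact le_max_of_le_left hK
        · simp only [pow_one]
          exact le_max_right _ _
      · calc |c n| * (1 / C) ^ n ≤ K * C ^ n * (1 / C) ^ n := by
              apply mul_le_mul_of_nonneg_right (hc_bound n hn) (by positivity)
          _ = K := by
              rw [mul_assoc, ← mul_pow, mul_one_div_cancel hC.ne', one_pow, mul_one]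
          _ ≤ max K (|c 1| * (1 / C)) := le_max_left _ _
    exact p.le_radius_of_bound (max K (|c 1| * (1 / C))) key
  have hradius_pos : 0 < p.radius := lt_of_lt_of_le (by simp [hC]) hradius
  -- the sum `g` of the series is analytic on the ball of radius `p.radius ⊇ U`
  set g : ℝ → ℝ := p.sum with hg_def
  have hgp : HasFPowerSeriesOnBall g p 0 p.radius := p.hasFPowerSeriesOnBall hradius_pos
  have hU_ball : U ⊆ Metric.eball (0 : ℝ) p.radius := by
    intro y hy
    have hy' : |y| < 1 / C := by
      rw [abs_lt]; constructor <;> linarith [hy.1, hy.2, min_le_right (R + δ) (1 / C)]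
    rw [Metric.mem_eball, edist_zero_right, ← ofReal_norm, Real.norm_eq_abs]
    exact lt_of_lt_of_le ((ENNReal.ofReal_lt_ofReal_iff (by positivity)).2 hy') hradius
  have hg_an : AnalyticOnNhd ℝ g U := fun y hy => hgp.analyticAt_of_mem (hU_ball hy)
  -- `f = g` near `0`, hence on `U` by the identity theorem
  have hfg0 : f =ᶠ[𝓝 0] g := by
    obtain ⟨r', hr'⟩ := hfp
    have h1 := hr'.eventually_hasSum
    have h2 := (hgp.mono hradius_pos le_rfl).hasFPowerSeriesAt.eventually_hasSum
    filter_upwards [h1, h2] with y hy1 hy2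
    rw [zero_add] at hy1 hy2
    exact hy1.unique hy2
  have hfgU : EqOn f g U :=
    (hf_an.mono hU_sub_S).eqOn_of_preconnected_of_eventuallyEq hg_an isPreconnected_Ioo h0U hfg0
  have hft : f t = g t := hfgU htU
  -- evaluate the series at `t`
  have hsum : HasSum (fun n => c n * t ^ n) (g t) := by
    have h := hgp.hasSum (hU_ball htU)
    rw [zero_add] at h
    have h' : (fun n => p n fun _ => t) = fun n => c n * t ^ n := by
      funext n
      rw [hp_def, FormalMultilinearSeries.ofScalars_apply_eq, smul_eq_mul]
    rw [h'] at h
    exact h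
  -- split off the first two terms
  have htail : HasSum (fun n => c (n + 2) * t ^ (n + 2)) (g t - (c 0 * t ^ 0 + c 1 * t ^ 1)) := by
    have := (hasSum_nat_add_iff' 2).2 hsum
    simpa [Finset.sum_range_succ] using this
  -- geometric majorant
  set q : ℝ := C * |t| with hq_def
  have hq0 : 0 ≤ q := by positivity
  have hq1 : q < 1 := by linarith
  have hgeom : HasSum (fun n => K * q ^ 2 * q ^ n) (K * q ^ 2 * (1 - q)⁻¹) :=
    (hasSum_geometric_of_lt_one hq0 hq1).mul_left (K * q ^ 2)
  have hterm : ∀ n : ℕ, c (n + 2) * t ^ (n + 2) ≤ K * q ^ 2 * q ^ n := by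
    intro n
    calc c (n + 2) * t ^ (n + 2) ≤ |c (n + 2) * t ^ (n + 2)| := le_abs_self _
      _ = |c (n + 2)| * |t| ^ (n + 2) := by rw [abs_mul, abs_pow]
      _ ≤ K * C ^ (n + 2) * |t| ^ (n + 2) :=
          mul_le_mul_of_nonneg_right (hc_bound (n + 2) (by omega)) (by positivity)
      _ = K * q ^ 2 * q ^ n := by rw [hq_def]; ring
  have htail_le : g t - (c 0 * t ^ 0 + c 1 * t ^ 1) ≤ K * q ^ 2 * (1 - q)⁻¹ :=
    hasSum_le hterm htail hgeom
  -- conclude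
  have hinv : (1 - q)⁻¹ ≤ 2 := by
    rw [inv_le_comm₀ (by linarith) (by norm_num)]; linarith
  have hq2 : q ^ 2 = C ^ 2 * t ^ 2 := by rw [hq_def, mul_pow, sq_abs]
  calc cgf X μ t = g t := hft
    _ ≤ (c 0 * t ^ 0 + c 1 * t ^ 1) + K * q ^ 2 * (1 - q)⁻¹ := by linarith
    _ = t * (∫ ω, X ω ∂μ) + K * q ^ 2 * (1 - q)⁻¹ := by rw [hc0, hc1]; ring
    _ ≤ t * (∫ ω, X ω ∂μ) + K * q ^ 2 * 2 := by
        have : 0 ≤ K * q ^ 2 := by positivity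
        nlinarith
    _ = t * (∫ ω, X ω ∂μ) + 2 * K * C ^ 2 * t ^ 2 := by rw [hq2]; ring

end Summit.AtomisticToContinuum.HydrodynamicLimit.Cruxes.KineticWindowLDUniform.IdeatorOne

end
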